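import Summits.ResolutionOfSingularities.ResolutionOfSingularities.Theorems.FrobeniusLadderFInjectiveMacaulayficationCNConeFiModelRel
import HarnessLib

/-!
# (H3-rel) REGISTERED STUB `stub_cnConeFiModelRel` CLOSED BY NAME (skeleton v19 `02fcd730f30618f7` §19.2, res-L1-w45a-plan-1's
# `L/w45a/Stubs-v19.lean` fe36a58e936a452f §2 VERBATIM) — crux `FInjectiveMacaulayfication` stmt-ResolutionOfSingularities-15315

Support file for crux stmt-ResolutionOfSingularities-15315 (`FrobeniusLadder.FInjectiveMacaulayfication`), chain w45a, seat
res-D-pv-017 AS res-L1-w45a-stub-5. [OURS · L1 W4.5a] — NOT a statement of any manuscript; AI-written, weaker than expert review.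

The registered text carries, per chart, the divisibility datum `(∀ c, ∃ N r, N • m c = Σ dv c i • a c i + r)` of
`CNConeFiModel.cnConeFiModel`; the landed relative engine `CNConeFiModelRel.cnConeFiModelRel` (p497132, built on the PRIME chart
presentation p495258) does not need it, so the stub is that theorem with the extra hypothesis discarded. No definitions, no named
facts. [folklore]
-/

-- single-problem summit: the doubled namespace component is forced
set_option linter.dupNamespace false

noncomputable section

open AlgebraicGeometry CategoryTheory Literature.AlgebraicGeometry.Resolution MvPolynomial

namespace Summit.ResolutionOfSingularities.ResolutionOfSingularities.Theorems.FInjectiveMacaulayfication.CNConeFiModelRelStub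

open Summit.ResolutionOfSingularities.ResolutionOfSingularities.Theorems.FInjectiveMacaulayfication

/-- **(H3-rel) `stub_cnConeFiModelRel`, the registered v19 stub VERBATIM** — the CN engine relative to a coordinate stratum
`J ⊆ Fin n`: the blow-up of `Spec k[X]/(f)` in a monomial ideal `I_A` cosupported on `V(X_J)` ((prim) on `J` only), covered by
unimodular vertex charts, is a proper birational model whose stalks are CM domains with Frobenius-closed parameter ideals, given
the clause off `V(X_J)` and the Cartier–Newton face conditions positive on `J`. Proof: `CNConeFiModelRel.cnConeFiModelRel`
(p497132), the `hunit` datum unused. [folklore] -/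
theorem stub_cnConeFiModelRel :
    ∀ (p : ℕ) [Fact p.Prime] (k : Type) [Field k] [CharP k p] (n : ℕ) (J : Finset (Fin n)), J.Nonempty →
    ∀ (A : Finset (Fin n →₀ ℕ)), (∀ e ∈ A, ∃ j ∈ J, 0 < e j) →
    (∀ j ∈ J, ∃ e : ℕ, 0 < e ∧ Finsupp.single j e ∈ A) →
    ∀ (t : ℕ), 0 < t → ∀ (V : Fin t → Matrix (Fin n) (Fin n) ℕ), (∀ c, IsUnit ((V c).map (Nat.cast : ℕ → ℤ)).det) →
    ∀ (m : Fin t → (Fin n →₀ ℕ)), (∀ c, m c ∈ A) →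
    ∀ (a : Fin t → Fin n → (Fin n →₀ ℕ)), (∀ c i, a c i ∈ A) →
    (∀ (c : Fin t) (i : Fin n), (Finsupp.equivFunOnFinite.symm ((V c).mulVec ⇑(a c i)) : Fin n →₀ ℕ) =
      Finsupp.equivFunOnFinite.symm ((V c).mulVec ⇑(m c)) + Finsupp.single i 1) →
    (∀ (c : Fin t), ∀ e ∈ A, (Finsupp.equivFunOnFinite.symm ((V c).mulVec ⇑(m c)) : Fin n →₀ ℕ) ≤
      Finsupp.equivFunOnFinite.symm ((V c).mulVec ⇑e)) →
    (∀ e ∈ A, ∃ (c : Fin t) (K : ℕ), 1 ≤ K ∧ ∃ y ∈ (Ideal.span ((fun b : Fin n →₀ ℕ => (MvPolynomial.monomial b (1 : k) : MvPolynomial (Fin n) k)) '' (A : Set (Fin n →₀ ℕ)))) ^ (K - 1),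
      (MvPolynomial.monomial e (1 : k) : MvPolynomial (Fin n) k) ^ K = MvPolynomial.monomial (m c) 1 * y) →
    ∀ (f : MvPolynomial (Fin n) k), (Ideal.span {f}).IsPrime →
    (∀ v : Fin n, Ideal.Quotient.mk (Ideal.span {f}) (MvPolynomial.X v) ≠ 0) →
    (∀ (Q : Ideal (MvPolynomial (Fin n) k ⧸ Ideal.span {f})) [Q.IsMaximal],
      (∃ j ∈ J, Ideal.Quotient.mk (Ideal.span {f}) (MvPolynomial.X j) ∉ Q) →
      ∀ d : ℕ, ringKrullDim (Localization.AtPrime Q) = d → ∀ s : Fin d → Localization.AtPrime Q,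
        (Ideal.span (Set.range s)).radical.IsMaximal →
          RingTheory.Sequence.IsWeaklyRegular (Localization.AtPrime Q) (List.ofFn s) ∧
          ∀ y : Localization.AtPrime Q, (∃ e : ℕ, y ^ p ^ e ∈ Ideal.span
            ((fun z : Localization.AtPrime Q => z ^ p ^ e) ''
              (Ideal.span (Set.range s) : Set (Localization.AtPrime Q)))) → y ∈ Ideal.span (Set.range s)) →
    (∀ (c : Fin t) (S : Finset (Fin n)), (∀ j ∈ J, 0 < ∑ i ∈ S, V c i j) →
      (∀ D : ℕ, (MvPolynomial.weightedHomogeneousComponent (fun j : Fin n => ∑ i ∈ S, V c i j) D f ≠ 0 ∧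
          ∀ D' < D, MvPolynomial.weightedHomogeneousComponent (fun j : Fin n => ∑ i ∈ S, V c i j) D' f = 0) →
        ∀ (K : Type) [Field K] [Algebra k K] (b : Fin n → K), (∀ i, b i ≠ 0) →
          MvPolynomial.aeval b (MvPolynomial.weightedHomogeneousComponent (fun j : Fin n => ∑ i ∈ S, V c i j) D f) = 0 →
          (MvPolynomial.map (algebraMap k K) (MvPolynomial.weightedHomogeneousComponent (fun j : Fin n => ∑ i ∈ S, V c i j) D f)) ^ (p - 1) ∉
            Ideal.span (Set.range fun i : Fin n => (MvPolynomial.X i - MvPolynomial.C (b i)) ^ p))) →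
    ∀ (dv : Fin t → (Fin n →₀ ℕ)) (g : Fin t → MvPolynomial (Fin n) k),
    (∀ c, MvPolynomial.aeval (fun j : Fin n => ∏ i : Fin n, (MvPolynomial.X i : MvPolynomial (Fin n) k) ^ V c i j) f = MvPolynomial.monomial (dv c) 1 * g c) →
    (∀ c, ∃ (N : ℕ) (r : Fin n →₀ ℕ), N • m c = ∑ i : Fin n, dv c i • a c i + r) →
    (∀ c, ∀ i : Fin n, ¬ (MvPolynomial.X i ∣ g c)) →
    (∀ c, ∃ m ∈ f.support, ∀ i : Fin n, ∑ j : Fin n, V c i j * m j = dv c i) →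
    ∃ (X' : Scheme.{0}) (π : X' ⟶ Spec (.of (MvPolynomial (Fin n) k ⧸ Ideal.span {f}))), IsProper π ∧
      Literature.AlgebraicGeometry.Resolution.IsBirational π ∧
      ∀ y : X', IsDomain (X'.presheaf.stalk y) ∧ ∀ d : ℕ, ringKrullDim (X'.presheaf.stalk y) = d →
        ∀ s : Fin d → X'.presheaf.stalk y, (Ideal.span (Set.range s)).radical.IsMaximal →
          RingTheory.Sequence.IsWeaklyRegular (X'.presheaf.stalk y) (List.ofFn s) ∧
          ∀ z : X'.presheaf.stalk y, (∃ e : ℕ, z ^ p ^ e ∈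
              Ideal.span ((fun w : X'.presheaf.stalk y => w ^ p ^ e) ''
                (Ideal.span (Set.range s) : Set (X'.presheaf.stalk y)))) →
            z ∈ Ideal.span (Set.range s) := by
  intro p _ k _ _ n J hJ A hAJ hprim t ht V hV m hm a haA hgen hge hcov f hfprime hXne hoff hCN dv g hg _hunit hndiv hface
  exact CNConeFiModelRel.cnConeFiModelRel p k n J hJ A hAJ hprim t ht V hV m hm a haA hgen hge hcov f hfprime hXne hoff hCN
    dv g hg hndiv hface

end Summit.ResolutionOfSingularities.ResolutionOfSingularities.Theorems.FInjectiveMacaulayfication.CNConeFiModelRelStub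

end
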